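import Summits.KontsevichZagierPeriods.KontsevichZagierPeriods.Theorems.OctahedralSymmetryLevelFourStuffleInKZStubTransportCubical

/-!
# `ZhaoRelationInKZ` (stmt-KontsevichZagierPeriods-9433, route `OctahedralSymmetry`), line `Sketch`:
# stub `stub_transportCubical`

ONE change-of-variables move of the Kontsevich–Zagier calculus (rule (2)): a representation `A`
on the literal ordered simplex `{1 > t₀ > t₁ > t₂ > 0}` is KZ-equivalent to its pull-back `At`
on the open cube `(0,1)³` along the cumulative monomial chart `Φ(s) = (s₀, s₀s₁, s₀s₁s₂)`
(a bijection of the open cube onto the simplex with Jacobian determinant `s₀²s₁ > 0`); the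
pulled-back representation EXISTS because semialgebraicity and absolute integrability are
transported along the chart (`monomialChart_transport`, instance `N = 3`).

The statement is verbatim the stub of the same name of the sibling crux `LevelFourStuffleInKZ`
(route `OctahedralSymmetry`), already established in
`OctahedralSymmetryLevelFourStuffleInKZStubTransportCubical.lean`; this file records it under the
namespace of the crux `ZhaoRelationInKZ`, whose stuffle engine consumes it.

References: M. Kontsevich, D. Zagier, *Periods* (2001), §1.2 rule (2).
-/

noncomputable section

open Set MeasureTheory
open Literature.NumberTheory.Transcendental Literature.NumberTheory.Transcendental.KZ

namespace Summit.KontsevichZagierPeriods.OctahedralSymmetry.ZhaoRelationInKZ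

/-- **Stub `stub_transportCubical`** (rule (2), one move): every representation on the literal
ordered simplex `{1 > t₀ > t₁ > t₂ > 0}` has a pull-back to the open cube `(0,1)³` along the
cumulative chart `s ↦ (s₀, s₀s₁, s₀s₁s₂)` (Jacobian `s₀²s₁`), KZ-equivalent to it by ONE
`KZ.changeOfVariablesRel` move (the instance `N = 3` of `monomialChart_transport`, via the
sibling crux `LevelFourStuffleInKZ`). [cite: KontsevichZagier2001, §1.2 rule (2)] -/
theorem stub_transportCubical (A : IntegralRep 3)
    (hA : A.domain = {t | 1 > t 0 ∧ t 0 > t 1 ∧ t 1 > t 2 ∧ t 2 > 0}) :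
    ∃ At : IntegralRep 3, At.domain = {s | ∀ i, s i ∈ Set.Ioo (0:ℝ) 1} ∧
      (∀ s ∈ {s : Fin 3 → ℝ | ∀ i, s i ∈ Set.Ioo (0:ℝ) 1},
        At.integrand s = A.integrand ![s 0, s 0 * s 1, s 0 * s 1 * s 2] * (s 0 ^ 2 * s 1)) ∧
      of At - of A ∈ relations :=
  LevelFourStuffleInKZ.stub_transportCubical A hA

end Summit.KontsevichZagierPeriods.OctahedralSymmetry.ZhaoRelationInKZ
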